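import Literature.NumberTheory.Sieve.HeathBrownCubicSieveDecomposition
import HarnessLib

/-!
# Heath-Brown's upper-bound sieve lemma over `K = ℚ(2^{1/3})` (Lemma 7.1) — named fact

Tenth layer of the decomposition of **parity.S18** along Heath-Brown, *Primes represented by
`x³ + 2y³`*, Acta Math. 186 (2001), 1–84, continuing `HeathBrownCubicSieveDecomposition` (the pieces
`S₁, …, S₇` of the Buchstab decomposition and the named facts Lemma 3.5, Lemma 3.6). §7 of the paper
("Upper bound sieve results", pp. 39–47) proves Lemmas 3.6 and 3.7 from one tool, **Lemma 7.1**
(p. 39): a Selberg upper bound for the sifting functions `S_K(𝒜^(K)_Q, z)`, `S_K(ℬ^(K)_Q, z)` summed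
over ideals `Q` with square-free norms in a dyadic range `N < N(Q) ≤ 2N` ("For the proof we begin by
converting our problem into one which involves only rational numbers … We now apply the form of
Selberg's upper bound sieve given by Halberstam and Richert [6, Theorem 4.1] … and use Lemmas 3.2
and 3.3 to bound the error terms", pp. 40–41; the products `W(z)` are bounded through the
Mertens-type estimates (6.9), (6.10) over `K`).

This file vendors Lemma 7.1 as a named fact in the corrected form that its proof establishes and
its applications use, `HeathBrown2001_lemma_7_1_normWeighted` (the printed ranges `∑_{N(Q)∈𝒬}`, but
the weight `∑_{N(Q)∈𝒬} N(Q)^{-1}` over the ideals in place of the printed `∑_{q∈𝒬} q^{-1}`; see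
*Misstatement* below), on the objects of `HeathBrownCubicSieveSetup` (`siftedA X η Q z = S_K(𝒜^(K)_Q, z)`,
`siftedB X η Q z = S_K(ℬ^(K)_Q, z)`), together with the finite set `normIn 𝒬` of ideals whose norm
lies in a finite set `𝒬 ⊆ ℕ`. The companion pure-proof files `HeathBrownCubicUpperBoundIdealTools`,
`HeathBrownCubicUpperBoundProofs` derive **Lemma 3.6 from Lemma 7.1** (pp. 41–42), so that in the
frontier of parity.S18 the paper-specific Lemma 3.6 is replaced by the sieve lemma on which Lemma 3.7
(§7, pp. 42–47) also rests.

## The printed lemma and its rendering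

* "LEMMA 7.1. Let `𝒬` be a set of square-free integers `q` with `N < q ≤ 2N`. Suppose that
  `z ≫ X^τ` and `N ≪ X^{2−τ}`. Then
  `∑_{N(Q) ∈ 𝒬} S_K(𝒜^(K)_Q, z) ≪ ∑_{q ∈ 𝒬} η²X²/(q log min(z, X^{2−τ}/N)) + X^{2−τ/5}` and
  `∑_{N(Q) ∈ 𝒬} S_K(ℬ^(K)_Q, z) ≪ ∑_{q ∈ 𝒬} ηX³/(q log min(z, X^{2−τ}/N)) + X^{3−τ/5}`" (p. 39), in
  the standing set-up of the paper: `X → ∞`, `η` in the range (2.1) `exp(−(log X)^{1/3}) ≤ η ≤ 1`,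
  `τ = (log log X)^{−ϖ}` ((2.5), `ϖ` a positive absolute constant subject to (3.10) `0 < ϖ < 1/5`),
  implied constants uniform in `𝒬, N, z, η`.
* Rendered (`HeathBrown2001_lemma_7_1_normWeighted`): the sums on the left range, as printed, over all
  ideals `Q` of `𝓞_K` whose norm lies in `𝒬` (`normIn 𝒬`), `𝒬` a finite set of square-free integers
  in `(N, 2N]`; the weight on the right is `∑_{N(Q) ∈ 𝒬} N(Q)^{-1}` — the sum over the same IDEALS —
  in place of the printed `∑_{q ∈ 𝒬} q^{-1}`. This is the form in which the paper itself applies the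
  lemma ((7.3)–(7.4), p. 42: "`≪ ∑_{N(Q)∈𝒬} η²X²/(N(Q) τ log X) + X^{2−τ/5}` … Moreover
  `∑_{N(Q)∈𝒬} N(Q)^{-1} ≤ …`"), and it is what the printed proof yields once the factor `ρ₀(q)`
  dropped on p. 40 is restored (`∑_{N(Q) ∈ 𝒬} N(Q)^{-1} ≥ ∑_{q∈𝒬} ρ₀(q)/q`, see *Misstatement*).
  Bounds for a sub-family of the ideals of given norms follow from the non-negativity of the left
  side, with the weight still taken over all ideals of those norms (`HeathBrownCubicUpperBoundProofs`).
* The hypotheses "`z ≫ X^τ` and `N ≪ X^{2−τ}`" are rendered as `X^τ ≤ z` and `0 < N ≤ X^{2−2τ}`.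
  This is the special case of implied constants `1` further restricted to `N ≤ X^{2−2τ}`, which is
  how the lemma is used: "we note at the outset that in every application of Lemma 7.1 we will have
  `z ≫ X^τ` and `N ≪ X^{2−2τ}`, so that `min(z, X^{2−τ}/N) ≫ X^τ`" (p. 42; the applications on
  p. 41 to Lemma 3.6 have `N ≤ 2X^{3/2}`). Under it `log min(z, X^{2−τ}/N) ≥ τ log X > 0`, so the
  right-hand side is a genuine (positive) bound; restricting the hypotheses only weakens the fact.
* Quantifier structure as for `HeathBrown2001_lemma_3_5`/`_3_6`: for every `ϖ ∈ (0, 1/5)` there are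
  `C, X₀` (depending on `ϖ`) such that both bounds hold with constant `C` for all `X ≥ X₀`, all `η`
  in the range (2.1), and all admissible `N, z, 𝒬`. Square-free `q` are nonzero, so `normIn 𝒬`
  never contains the zero ideal; the unit ideal (`q = 1`, possible only for `N < 1`) is harmless.

## Misstatement (record; the literal rendering `HeathBrown2001_lemma_7_1` of p12834 is withdrawn)

Read literally — left side over all ideals `Q` with `N(Q) ∈ 𝒬`, right side weighted by
`∑_{q∈𝒬} q^{-1}`, one constant for all `𝒬` — the display does not follow from its proof and is
contradicted by the expected size of the left side, so it must not be offered as a hypothesis: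
* What the proof gives. By (6.2) (p. 34) `∑_{N(Q) = q} S_K(𝒜^(K)_Q, z) = S(𝒜_q, z)` for square-free
  `q` with prime factors `≥ z`, and by Lemma 2.1 / (6.3) `#𝒜_{qd} = (6η²X²/π²) ρ₀(qd)/(qd) + R_{qd}`
  with `ρ₀(p) = ν_p(1 + p^{-1})^{-1}`; so Selberg's sieve (Halberstam–Richert Thm. 4.1) applies to
  `𝒜_q` with `'X' = (6η²X²/π²) ρ₀(q)/q`, `'ω(d)' = ρ₀(d)`, giving
  `S(𝒜_q, z₀) ≪ η²X² ρ₀(q)/(q log z₀) + (remainders)`. The proof on p. 40 writes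
  `'X' = 6η²X²/(π²q)`, dropping the factor `ρ₀(q)`; with it restored the main term summed over `q ∈ 𝒬`
  is `η²X² (log z₀)^{-1} ∑_{q∈𝒬} ρ₀(q)/q`, and `∑_{q∈𝒬} ρ₀(q)/q ≤ ∑_{N(Q)∈𝒬} N(Q)^{-1}` (there are
  `∏_{p∣q} ν_p ≥ ρ₀(q)` ideals of square-free norm `q` with prime factors `≥ z`, Dedekind / Lemma 3.1),
  the remainders being controlled by Lemma 3.2 summed over `N(R) ≤ 2X^{2−τ}` exactly as printed
  ("Since `Nz₀² ≤ X^{2−τ}` … we deduce …", p. 40). The `ℬ`-side is identical with (6.4) and Lemma 3.3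
  in place of (6.2) and Lemma 3.2. So the proof yields the per-norm totals `∑_{N(Q)∈𝒬}` with the
  ideal weight `∑_{N(Q)∈𝒬} N(Q)^{-1}` — the rendering below — and no more (a bound for a single ideal
  or an arbitrary sub-family with weight `N(Q)^{-1}` would need a Selberg sieve over the ideals of `K`
  built on the per-ideal Lemma 3.2, which the paper does not carry out; review of p14956).
* Why the literal weight is wrong. `ρ₀(q) ≍ ∏_{p ∣ q} ν_p` is as large as `3^{ω(q)}`, unboundedly
  often; for `𝒬` = the square-free `q ∈ (N, 2N]`, `N = X^{2−2τ}`, all of whose prime factors are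
  `≥ X^τ` and split completely, the left side is by the Fundamental Lemma of the expected order
  `η²X²(log z₀)^{-1} ∑_{q∈𝒬} ρ₀(q)/q`, which exceeds `∑_{q∈𝒬} q^{-1}` by a factor growing like a
  power of `τ^{-1} = (log log X)^{ϖ}`, while `X^{2−τ/5}` is of lower order in this range of `η`
  ((2.1)). So no constant `C` uniform in `𝒬` can exist; the paper never uses the display in that
  form (its two applications, p. 41 and (7.3)–(7.4), weight by ideals or have `𝒬 ⊆` primes, where
  the two weights agree up to the factor `3`).
The literal `def HeathBrown2001_lemma_7_1` (accepted with p12834, no users) is therefore deleted in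
this revision rather than kept with a warning (review of p14080: a cited `def … : Prop` is the tree's
claim of a published result, D-0014).

## References

* D. R. Heath-Brown, *Primes represented by `x³ + 2y³`*, Acta Math. 186 (2001), 1–84: Lemma 7.1
  (p. 39) and its proof (pp. 40–41); (6.2)–(6.4) (pp. 34–35); the applications (p. 41, and
  (7.3)–(7.4), p. 42). [cite: HeathBrownActa2001, Lemma 7.1]
* H. Halberstam, H.-E. Richert, *Sieve Methods*, Academic Press (1974), Theorem 4.1 (Selberg's
  upper bound sieve), the form used in the proof. [cite: HeathBrownActa2001, §7 p. 40]

## Mathlib / tree search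

Mathlib has the `Λ²` set-up of the Selberg sieve for sequences of rational integers
(`Mathlib.NumberTheory.SelbergSieve`: `siftedSum_le_mainSum_errSum_of_upperMoebius`,
`upperMoebius_lambdaSquared`, `mainSum_lambdaSquared_eq_sum_mul_sum_sq`), not the optimised bound,
not over number fields and without the Type I inputs needed here (searched `Selberg`, `siftedSum`,
`upperMoebius`); the tree has `Literature.NumberTheory.Sieve.SieveFramework` (`selbergSum`). Tree
objects used: `HeathBrownCubicSieveSetup` (`siftedA`, `siftedB`, `idealsLE`),
`HeathBrownCubicSieveDecomposition` (`hbTau`).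
-/

noncomputable section

open NumberField Finset

namespace Literature.NumberTheory.Sieve.CubicSieve

open LFunctions.CubeRootTwoField

/-! ### Ideals with norm in a given finite set of integers -/

open scoped Classical in
/-- The (finite) set of ideals `Q` of `𝓞_K` whose norm lies in the finite set `𝒬 ⊆ ℕ`: the range
`∑_{N(Q) ∈ 𝒬}` of Lemma 7.1. (Bounded by `idealsLE (max 𝒬)`; if `0 ∈ 𝒬` the zero ideal is a
member, harmlessly — Lemma 7.1 concerns square-free, hence nonzero, `q`.)
[cite: HeathBrownActa2001, Lemma 7.1] -/
def normIn (𝒬 : Finset ℕ) : Finset (Ideal (𝓞 K)) :=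
  {Q ∈ idealsLE (𝒬.sup id) | Ideal.absNorm Q ∈ 𝒬}

/-- Membership in `normIn 𝒬`: the bounding norm is redundant. [cite: HeathBrownActa2001, Lemma 7.1] -/
@[simp] theorem mem_normIn_iff {𝒬 : Finset ℕ} {Q : Ideal (𝓞 K)} :
    Q ∈ normIn 𝒬 ↔ Ideal.absNorm Q ∈ 𝒬 := by
  classical
  simp only [normIn, mem_filter, mem_idealsLE, and_iff_right_iff_imp]
  exact fun h => Finset.le_sup (f := id) h

/-- `normIn ∅ = ∅`. [folklore] -/
@[simp] theorem normIn_empty : normIn ∅ = ∅ := by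
  ext Q; simp

/-! ### Lemma 7.1 — named fact (corrected, ideal-weighted form) -/

/-- **Heath-Brown's Lemma 7.1 (the upper-bound sieve over `K`), corrected form.** Printed (p. 39):
"Let `𝒬` be a set of square-free integers `q` with `N < q ≤ 2N`. Suppose that `z ≫ X^τ` and
`N ≪ X^{2−τ}`. Then
`∑_{N(Q) ∈ 𝒬} S_K(𝒜^(K)_Q, z) ≪ ∑_{q ∈ 𝒬} η²X² / (q log min(z, X^{2−τ}/N)) + X^{2−τ/5}` and
`∑_{N(Q) ∈ 𝒬} S_K(ℬ^(K)_Q, z) ≪ ∑_{q ∈ 𝒬} ηX³ / (q log min(z, X^{2−τ}/N)) + X^{3−τ/5}`",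
proved on pp. 40–41 from Selberg's upper bound sieve (Halberstam–Richert, Thm. 4.1) with
`z₀ = min(z^{1/2}, N^{-1/2}X^{1−τ/2})`, the Type I bounds Lemmas 3.2/3.3 for the remainders and
(6.9), (6.10) for the products `W(z₀)`. Corrected form: the weight is `∑_{N(Q)∈𝒬} N(Q)^{-1}`
(`≥ ∑_{q∈𝒬} ρ₀(q)/q`, which is what pp. 40–41 prove once the factor `ρ₀(q)` dropped in
"`'X' = 6η²X²/(π²q)`" is restored; it is also the weight the paper uses in (7.3)–(7.4), p. 42), in
place of the printed `∑_{q∈𝒬} q^{-1}`, with which the display fails (module docstring,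
*Misstatement*). Rendered: for every `ϖ ∈ (0, 1/5)` there are `C, X₀` such that for all `X ≥ X₀`,
all `η` with `exp(−(log X)^{1/3}) ≤ η ≤ 1` ((2.1)), `τ = (log log X)^{−ϖ}` (`hbTau`, (2.5)), all
reals `N, z` with `X^τ ≤ z`, `0 < N ≤ X^{2−2τ}` (the paper's "`z ≫ X^τ`, `N ≪ X^{2−τ}`" in the form
of p. 42, under which `min(z, X^{2−τ}/N) ≥ X^τ`) and every finite set `𝒬` of square-free integers
`q` with `N < q ≤ 2N`:
`∑_{N(Q)∈𝒬} S_K(𝒜^(K)_Q, z) ≤ C (η²X² / log min(z, X^{2−τ}/N) · ∑_{N(Q)∈𝒬} N(Q)^{-1} + X^{2−τ/5})`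
and
`∑_{N(Q)∈𝒬} S_K(ℬ^(K)_Q, z) ≤ C (ηX³ / log min(z, X^{2−τ}/N) · ∑_{N(Q)∈𝒬} N(Q)^{-1} + X^{3−τ/5})`;
`S_K(𝒜^(K)_Q, z)`, `S_K(ℬ^(K)_Q, z)` are `siftedA X η Q z`, `siftedB X η Q z` of
`HeathBrownCubicSieveSetup`, `∑_{N(Q)∈𝒬}` is `∑ Q ∈ normIn 𝒬`. [cite: HeathBrownActa2001, Lemma 7.1] -/
def HeathBrown2001_lemma_7_1_normWeighted : Prop :=
  ∀ ϖ : ℝ, 0 < ϖ → ϖ < 1 / 5 →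
    ∃ C X₀ : ℝ, ∀ X η : ℝ, X₀ ≤ X → Real.exp (-Real.log X ^ (1 / 3 : ℝ)) ≤ η → η ≤ 1 →
      ∀ (N z : ℝ) (𝒬 : Finset ℕ), X ^ hbTau ϖ X ≤ z → 0 < N → N ≤ X ^ (2 - 2 * hbTau ϖ X) →
        (∀ q ∈ 𝒬, Squarefree q ∧ N < q ∧ (q : ℝ) ≤ 2 * N) →
        (∑ Q ∈ normIn 𝒬, (siftedA X η Q z : ℝ)) ≤
            C * (η ^ 2 * X ^ 2 / Real.log (min z (X ^ (2 - hbTau ϖ X) / N)) *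
                  ∑ Q ∈ normIn 𝒬, ((Ideal.absNorm Q : ℕ) : ℝ)⁻¹ + X ^ (2 - hbTau ϖ X / 5)) ∧
        (∑ Q ∈ normIn 𝒬, (siftedB X η Q z : ℝ)) ≤
            C * (η * X ^ 3 / Real.log (min z (X ^ (2 - hbTau ϖ X) / N)) *
                  ∑ Q ∈ normIn 𝒬, ((Ideal.absNorm Q : ℕ) : ℝ)⁻¹ + X ^ (3 - hbTau ϖ X / 5))

end Literature.NumberTheory.Sieve.CubicSieve

end
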